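import Literature.Probability.FitznerVanDerHofstad2017.NobleBoundsN1IotaAvg
import HarnessLib

/-!
# [FvdH17] App. B / §6.1: the open triangles `A^{ι,a,b}`, `Ā^{ι,a,b}` with the row `(a,b) = (0,0)` read from
§6.1 (Bound-Xi-case-abZero) — a primed, ADDITIVE copy of the `NobleBlocks` families (reading D74 (i))

Source: R. Fitzner, R. van der Hofstad, *Mean-field behavior for nearest-neighbor percolation in `d > 10`*,
Electron. J. Probab. **22** (2017) no. 43 [FvdH17]; extended version arXiv:1506.07977v2.  Two displays of the
source give the row `a = b = 0` of the open triangle with one pivotal edge: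
* §6.1, Case `a = 0, b = 0` (p. 59, TeX l.9903–9906, label `Bound-Xi-case-abZero`): "We use `u + e_ι ≠ z = t` and
  `u = w = b̲ ≠ z` to conclude `T_{1̲,1,1}(e_ι, t−u, 0) = Ā^{ι,0,0}(u,u,t,t)`."  — index order `1̲, 1, 1`
  (the pivotal BOND `0 — e_ι` exact length one, then `e_ι ↔ t−u` and `t−u ↔ 0` of length `≥ 1`);
* App. B, Table "Diagrams and definition of `A^{ι,a,b}(0,v,x,y)`" (p. 75, TeX l.10500), row `a = b = 0 (⇒ x = y,
  v = 0 ⇒ v ≠ y, x ≠ e)`: `T_{1,1̲,1}(e_ι, x, 0)` — index order `1, 1̲, 1`; and App. B (p. 78, l.10595)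
  `Ā^{ι,a,0} = A^{ι,a,0}`.

The landed `NobleBlocks.blockAiota₀` (hence `blockAbar₀`, `blockAbar`, `matAbarIota`, …) types the App. B table
(policy "App. B wins", DIVERGENCE D66 of the b2b-lace packet).  DIVERGENCE D74 (i) (carver, gen 20) records
that the two index orders are different letters and that the §6.1 display is the one the case analysis of §6.1
produces.  THIS MODULE DOES NOT DECIDE BETWEEN THEM and asserts no printed inequality false: it supplies the §6.1
reading as a PRIMED family — `blockAiota₀'`, `blockAiotaSt₀'`, `blockAiota'`, `blockAiotaSt'`, `blockAbar₀'`,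
`blockAbarSt₀'`, `blockAbar'`, `blockAbarSt'`, `matAiota'`, `matAiotaSt'`, `matAbarIota'`, `matAbarIotaSt'` —
equal to the landed decls in every row `(a,b) ≠ (0,0)` (`…_of_ne` lemmas) and carrying in row `(0,0)` the entry
`δ_{x,y} δ_{v,0} (1−δ_{v,y}) (1−δ_{x,e}) T_{1̲,1,1}(e, x, 0)` = `kd x y * kd v 0 * kdc v y * kdc x e * L.T (.eq 1)
(.ge 1) (.ge 1) e x 0` (same Kronecker prefactors as the landed row, only the length indices of `T` transposed);
nothing in `NobleBlocks.lean` is modified.  So that consumers can target either element, the summation lemmas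
of `NobleBoundsN1Summation` ((6.5)) and `NobleBoundsN1IotaAvg` ((BoundXiIotaOne-1), `ι`-averaged with the trivial
term) are restated GENERICALLY in the double-open family `A` (any translation-invariant `DirBlockFamily`;
`matAbar A`) and instanced on the primed element.  Any letter table `L : Letters d`, any `d`; no numeral; no
cited hypothesis — everything is a definition or a kernel-proved lemma.
-/

noncomputable section

namespace Literature.Probability.FitznerVanDerHofstad2017.NobleBlocks

open Literature.Probability.LatticeModels Literature.Probability.Percolation
open Literature.Probability.FitznerVanDerHofstad2017.BlockSummation
open Literature.Barriers.CriticalPhenomena (nobleXiIotaN nobleXiIotaN_nonneg)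
open scoped BigOperators ENNReal Matrix

local notation "𝐞" => Literature.Probability.Percolation.stepVec

variable {d : ℕ}

/-! ## A. The primed families -/

/-- The row `(a,b) = (0,0)` of `A^{ι}` / `A^{ι,*}` / `Ā^{ι}` / `Ā^{ι,*}` at base point `0`, read from §6.1
(Bound-Xi-case-abZero): `δ_{x,y} δ_{v,0} (1−δ_{v,y}) (1−δ_{x,e}) T_{1̲,1,1}(e, x, 0)`, `e = e_ι`.
[cite: FitznerVanDerHofstad2017, §6.1 (Bound-Xi-case-abZero) (arXiv:1506.07977v2 p. 59)] -/
def blockAiotaZero₀' (L : Letters d) (ι : Fin d × Bool) (v x y : Site d) : ℝ≥0∞ :=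
  kd x y * kd v 0 * kdc v y * kdc x (𝐞 ι) * L.T (.eq 1) (.ge 1) (.ge 1) (𝐞 ι) x 0

/-- `A^{ι,a,b}(0,v,x,y)` with row `(0,0)` from §6.1; all other rows as in App. B (`blockAiota₀`).
[cite: FitznerVanDerHofstad2017, App. B Table "definition of A^{ι,a,b}(0,v,x,y)" (arXiv:1506.07977v2 p. 75); §6.1 (Bound-Xi-case-abZero) (p. 59)] -/
def blockAiota₀' (L : Letters d) (ι : Fin d × Bool) (a b : Fin 3) (v x y : Site d) : ℝ≥0∞ :=
  if a = 0 ∧ b = 0 then blockAiotaZero₀' L ι v x y else blockAiota₀ L ι a b v x y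

/-- `A^{ι,a,b,*}(0,v,x,y)` with row `(0,0)` from §6.1 (row `b = 0` is repulsive in both tables).
[cite: FitznerVanDerHofstad2017, App. B, sentence after Table "definition of A^{ι,a,b}" (arXiv:1506.07977v2 p. 75); §6.1 (p. 59)] -/
def blockAiotaSt₀' (L : Letters d) (ι : Fin d × Bool) (a b : Fin 3) (v x y : Site d) : ℝ≥0∞ :=
  if a = 0 ∧ b = 0 then blockAiotaZero₀' L ι v x y else blockAiotaSt₀ L ι a b v x y

/-- `Ā^{ι,a,b}(0,v,x,y)` with row `(0,0)` from §6.1 (`Ā^{ι,a,0} = A^{ι,a,0}`).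
[cite: FitznerVanDerHofstad2017, App. B, display "double-open triangle Ā^{ι,a,b}" (arXiv:1506.07977v2 p. 78); §6.1 (p. 59)] -/
def blockAbar₀' (L : Letters d) (ι : Fin d × Bool) (a b : Fin 3) (v x y : Site d) : ℝ≥0∞ :=
  if a = 0 ∧ b = 0 then blockAiotaZero₀' L ι v x y else blockAbar₀ L ι a b v x y

/-- `Ā^{ι,a,b,*}(0,v,x,y)` with row `(0,0)` from §6.1.
[cite: FitznerVanDerHofstad2017, §5.1 Table "Ā^{ι,a,b,*}" (arXiv:1506.07977v2 p. 47); App. B (p. 78); §6.1 (p. 59)] -/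
def blockAbarSt₀' (L : Letters d) (ι : Fin d × Bool) (a b : Fin 3) (v x y : Site d) : ℝ≥0∞ :=
  if a = 0 ∧ b = 0 then blockAiotaZero₀' L ι v x y else blockAbarSt₀ L ι a b v x y

/-- `A^{ι,a,b}(u,v,x,y)`, primed. [cite: FitznerVanDerHofstad2017, App. B (arXiv:1506.07977v2 p. 75); §6.1 (p. 59)] -/
def blockAiota' (L : Letters d) (ι : Fin d × Bool) (a b : Fin 3) : Site d → Site d → Site d → Site d → ℝ≥0∞ :=
  ofBase (blockAiota₀' L ι a b)

/-- `A^{ι,a,b,*}(u,v,x,y)`, primed. [cite: FitznerVanDerHofstad2017, App. B (arXiv:1506.07977v2 p. 75); §6.1 (p. 59)] -/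
def blockAiotaSt' (L : Letters d) (ι : Fin d × Bool) (a b : Fin 3) : Site d → Site d → Site d → Site d → ℝ≥0∞ :=
  ofBase (blockAiotaSt₀' L ι a b)

/-- `Ā^{ι,a,b}(u,v,x,y)`, primed. [cite: FitznerVanDerHofstad2017, App. B (arXiv:1506.07977v2 p. 78); §6.1 (p. 59)] -/
def blockAbar' (L : Letters d) (ι : Fin d × Bool) (a b : Fin 3) : Site d → Site d → Site d → Site d → ℝ≥0∞ :=
  ofBase (blockAbar₀' L ι a b)

/-- `Ā^{ι,a,b,*}(u,v,x,y)`, primed. [cite: FitznerVanDerHofstad2017, §5.1 (arXiv:1506.07977v2 p. 47); §6.1 (p. 59)] -/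
def blockAbarSt' (L : Letters d) (ι : Fin d × Bool) (a b : Fin 3) : Site d → Site d → Site d → Site d → ℝ≥0∞ :=
  ofBase (blockAbarSt₀' L ι a b)

/-- `(A^ι)_{a,b}`, primed. [cite: FitznerVanDerHofstad2017, §5.1 "Elements of the bounds" (arXiv:1506.07977v2 p. 49)] -/
def matAiota' (L : Letters d) : Matrix (Fin 3) (Fin 3) ℝ≥0∞ := matB (blockAiota' L)

/-- `(A^{ι,*})_{a,b}`, primed. [cite: FitznerVanDerHofstad2017, §5.1 "Elements of the bounds" (arXiv:1506.07977v2 p. 49)] -/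
def matAiotaSt' (L : Letters d) : Matrix (Fin 3) (Fin 3) ℝ≥0∞ := matB (blockAiotaSt' L)

/-- `(Ā^ι)_{a,b}`, primed. [cite: FitznerVanDerHofstad2017, §5.1 "Elements of the bounds" (arXiv:1506.07977v2 p. 49)] -/
def matAbarIota' (L : Letters d) : Matrix (Fin 3) (Fin 3) ℝ≥0∞ := matAbar (blockAbar' L)

/-- `(Ā^{ι,*})_{a,b}`, primed. [cite: FitznerVanDerHofstad2017, §5.1 "Elements of the bounds" (arXiv:1506.07977v2 p. 49)] -/
def matAbarIotaSt' (L : Letters d) : Matrix (Fin 3) (Fin 3) ℝ≥0∞ := matAbar (blockAbarSt' L)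

/-! ## B. Row `(0,0)` and agreement with the landed families off `(0,0)` -/

section Rows

variable (L : Letters d) (ι : Fin d × Bool)

/-- The landed App. B row `(0,0)`: `T_{1,1̲,1}(e,x,0)`. [cite: FitznerVanDerHofstad2017, App. B Table "definition of A^{ι,a,b}", row a=b=0 (arXiv:1506.07977v2 p. 75)] -/
theorem blockAiota₀_zero_zero (v x y : Site d) :
    blockAiota₀ L ι 0 0 v x y = kd x y * kd v 0 * kdc v y * kdc x (𝐞 ι) * L.T (.ge 1) (.eq 1) (.ge 1) (𝐞 ι) x 0 :=
  rfl

/-- The primed §6.1 row `(0,0)`: `T_{1̲,1,1}(e,x,0)`. [cite: FitznerVanDerHofstad2017, §6.1 (Bound-Xi-case-abZero) (arXiv:1506.07977v2 p. 59)] -/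
theorem blockAiota₀'_zero_zero (v x y : Site d) :
    blockAiota₀' L ι 0 0 v x y = kd x y * kd v 0 * kdc v y * kdc x (𝐞 ι) * L.T (.eq 1) (.ge 1) (.ge 1) (𝐞 ι) x 0 := by
  simp [blockAiota₀', blockAiotaZero₀']

/-- [cite: FitznerVanDerHofstad2017, §6.1 (Bound-Xi-case-abZero) (arXiv:1506.07977v2 p. 59)] -/
theorem blockAiotaSt₀'_zero_zero (v x y : Site d) :
    blockAiotaSt₀' L ι 0 0 v x y = kd x y * kd v 0 * kdc v y * kdc x (𝐞 ι) * L.T (.eq 1) (.ge 1) (.ge 1) (𝐞 ι) x 0 := by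
  simp [blockAiotaSt₀', blockAiotaZero₀']

/-- `Ā^{ι,0,0} = A^{ι,0,0}` in the primed family too. [cite: FitznerVanDerHofstad2017, App. B (arXiv:1506.07977v2 p. 78); §6.1 (p. 59)] -/
theorem blockAbar₀'_zero_zero (v x y : Site d) :
    blockAbar₀' L ι 0 0 v x y = kd x y * kd v 0 * kdc v y * kdc x (𝐞 ι) * L.T (.eq 1) (.ge 1) (.ge 1) (𝐞 ι) x 0 := by
  simp [blockAbar₀', blockAiotaZero₀']

/-- [cite: FitznerVanDerHofstad2017, §5.1 Table "Ā^{ι,a,b,*}" (arXiv:1506.07977v2 p. 47); §6.1 (p. 59)] -/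
theorem blockAbarSt₀'_zero_zero (v x y : Site d) :
    blockAbarSt₀' L ι 0 0 v x y = kd x y * kd v 0 * kdc v y * kdc x (𝐞 ι) * L.T (.eq 1) (.ge 1) (.ge 1) (𝐞 ι) x 0 := by
  simp [blockAbarSt₀', blockAiotaZero₀']

variable {a b : Fin 3}

/-- Off row `(0,0)` the primed `A^{ι}` table is the landed one. [folklore] -/
theorem blockAiota₀'_of_ne (h : ¬(a = 0 ∧ b = 0)) : blockAiota₀' L ι a b = blockAiota₀ L ι a b := by
  funext v x y; simp [blockAiota₀', h]

/-- [folklore] -/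
theorem blockAiotaSt₀'_of_ne (h : ¬(a = 0 ∧ b = 0)) : blockAiotaSt₀' L ι a b = blockAiotaSt₀ L ι a b := by
  funext v x y; simp [blockAiotaSt₀', h]

/-- [folklore] -/
theorem blockAbar₀'_of_ne (h : ¬(a = 0 ∧ b = 0)) : blockAbar₀' L ι a b = blockAbar₀ L ι a b := by
  funext v x y; simp [blockAbar₀', h]

/-- [folklore] -/
theorem blockAbarSt₀'_of_ne (h : ¬(a = 0 ∧ b = 0)) : blockAbarSt₀' L ι a b = blockAbarSt₀ L ι a b := by
  funext v x y; simp [blockAbarSt₀', h]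

/-- [folklore] -/
theorem blockAiota'_of_ne (h : ¬(a = 0 ∧ b = 0)) : blockAiota' L ι a b = blockAiota L ι a b := by
  rw [blockAiota', blockAiota₀'_of_ne L ι h]; rfl

/-- [folklore] -/
theorem blockAiotaSt'_of_ne (h : ¬(a = 0 ∧ b = 0)) : blockAiotaSt' L ι a b = blockAiotaSt L ι a b := by
  rw [blockAiotaSt', blockAiotaSt₀'_of_ne L ι h]; rfl

/-- [folklore] -/
theorem blockAbar'_of_ne (h : ¬(a = 0 ∧ b = 0)) : blockAbar' L ι a b = blockAbar L ι a b := by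
  rw [blockAbar', blockAbar₀'_of_ne L ι h]; rfl

/-- [folklore] -/
theorem blockAbarSt'_of_ne (h : ¬(a = 0 ∧ b = 0)) : blockAbarSt' L ι a b = blockAbarSt L ι a b := by
  rw [blockAbarSt', blockAbarSt₀'_of_ne L ι h]; rfl

end Rows

/-- Off the entry `(0,0)` the primed `(A^ι)` is the landed one. [folklore] -/
theorem matAiota'_apply_of_ne (L : Letters d) {a b : Fin 3} (h : ¬(a = 0 ∧ b = 0)) :
    matAiota' L a b = matAiota L a b := by
  simp only [matAiota', matAiota, matB_apply, blockAiota'_of_ne L _ h]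

/-- [folklore] -/
theorem matAiotaSt'_apply_of_ne (L : Letters d) {a b : Fin 3} (h : ¬(a = 0 ∧ b = 0)) :
    matAiotaSt' L a b = matAiotaSt L a b := by
  simp only [matAiotaSt', matAiotaSt, matB_apply, blockAiotaSt'_of_ne L _ h]

/-- Off the entry `(0,0)` the primed `(Ā^ι)` is the landed one. [folklore] -/
theorem matAbarIota'_apply_of_ne (L : Letters d) {a b : Fin 3} (h : ¬(a = 0 ∧ b = 0)) :
    matAbarIota' L a b = matAbarIota L a b := by
  simp only [matAbarIota', matAbarIota, matAbar_apply, blockAbar'_of_ne L _ h]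

/-- [folklore] -/
theorem matAbarIotaSt'_apply_of_ne (L : Letters d) {a b : Fin 3} (h : ¬(a = 0 ∧ b = 0)) :
    matAbarIotaSt' L a b = matAbarIotaSt L a b := by
  simp only [matAbarIotaSt', matAbarIotaSt, matAbar_apply, blockAbarSt'_of_ne L _ h]

/-! ## C. Translation invariance -/

/-- [folklore] -/
theorem isTransInv_blockAiota' (L : Letters d) (ι : Fin d × Bool) (a b : Fin 3) :
    IsTransInv (blockAiota' L ι a b) := isTransInv_ofBase _
/-- [folklore] -/
theorem isTransInv_blockAiotaSt' (L : Letters d) (ι : Fin d × Bool) (a b : Fin 3) :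
    IsTransInv (blockAiotaSt' L ι a b) := isTransInv_ofBase _
/-- [folklore] -/
theorem isTransInv_blockAbar' (L : Letters d) (ι : Fin d × Bool) (a b : Fin 3) :
    IsTransInv (blockAbar' L ι a b) := isTransInv_ofBase _
/-- [folklore] -/
theorem isTransInv_blockAbarSt' (L : Letters d) (ι : Fin d × Bool) (a b : Fin 3) :
    IsTransInv (blockAbarSt' L ι a b) := isTransInv_ofBase _

/-! ## D. The summation lemmas, generic in the double-open family -/

/-- **(6.5), generic double-open family**: for ANY translation-invariant family `A^{κ,a,b}` (in particular
`blockAbar L`, `blockAbar' L`, `blockAbarSt L`, …), the `x`-space bound of shape (6.4) with left piece `PL`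
implies `Σ_x Ξ(x) ≤ P⃗L ᵛ* (Ā) ⬝ P⃗^E`, `(Ā) = matAbar A`.
[cite: FitznerVanDerHofstad2017, §6.1 (6.4)–(6.5) (arXiv:1506.07977v2 p. 58)] -/
theorem tsum_le_vecP_vecMul_matAbar_dotProduct_vecPE (L : Letters d) {A : DirBlockFamily d}
    (hA : ∀ κ a b, IsTransInv (A κ a b)) (PL : Fin 3 → Site d → Site d → ℝ≥0∞) (Ξ : Site d → ℝ≥0∞)
    (hΞ : ∀ x, Ξ x ≤ ∑' u, ∑' w, ∑' t, ∑' z, ∑ κ : Fin d × Bool, ∑ a : Fin 3, ∑ b : Fin 3,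
      PL a u w * A κ a b u w t z * blockPE L b (t - x) (z - x)) :
    ∑' x, Ξ x ≤ vecP PL ᵥ* matAbar A ⬝ᵥ vecPE L := by
  rw [← sum_sum_mul_mul_eq_vecMul_dotProduct]
  exact tsum_le_of_xSpaceBound' hA Ξ PL (blockPE L) hΞ

/-- Summing (6.x) over `ι`, generic double-open family. [cite: FitznerVanDerHofstad2017, §6.1 (6.x) (arXiv:1506.07977v2 p. 59)] -/
theorem sum_le_xSpaceBound_piotaFull_of (L : Letters d) (A : DirBlockFamily d)
    (Ξι : Fin d × Bool → Site d → ℝ≥0∞)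
    (hΞ : ∀ ι x, Ξι ι x ≤ ∑' u, ∑' w, ∑' t, ∑' z, ∑ κ : Fin d × Bool, ∑ a : Fin 3, ∑ b : Fin 3,
      (kdeltaPref ι κ a u w + blockPiota L ι a u w) * A κ a b u w t z * blockPE L b (t - x) (z - x))
    (x : Site d) :
    ∑ ι : Fin d × Bool, Ξι ι x ≤ ∑' u, ∑' w, ∑' t, ∑' z, ∑ κ : Fin d × Bool, ∑ a : Fin 3, ∑ b : Fin 3,
      piotaFull L a u w * A κ a b u w t z * blockPE L b (t - x) (z - x) := by
  calc ∑ ι : Fin d × Bool, Ξι ι x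
      ≤ ∑ ι : Fin d × Bool, ∑' u, ∑' w, ∑' t, ∑' z, ∑ κ : Fin d × Bool, ∑ a : Fin 3, ∑ b : Fin 3,
          (kdeltaPref ι κ a u w + blockPiota L ι a u w) * A κ a b u w t z * blockPE L b (t - x) (z - x) :=
        Finset.sum_le_sum fun ι _ => hΞ ι x
    _ = ∑' u, ∑' w, ∑' t, ∑' z, ∑ κ : Fin d × Bool, ∑ a : Fin 3, ∑ b : Fin 3,
          piotaFull L a u w * A κ a b u w t z * blockPE L b (t - x) (z - x) := by
        rw [← tsum_finsetSum]
        refine tsum_congr fun u => ?_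
        rw [← tsum_finsetSum]
        refine tsum_congr fun w => ?_
        rw [← tsum_finsetSum]
        refine tsum_congr fun t => ?_
        rw [← tsum_finsetSum]
        refine tsum_congr fun z => ?_
        rw [Finset.sum_comm]
        refine Finset.sum_congr rfl fun κ _ => ?_
        rw [Finset.sum_comm]
        refine Finset.sum_congr rfl fun a _ => ?_
        rw [Finset.sum_comm]
        refine Finset.sum_congr rfl fun b _ => ?_
        rw [← Finset.sum_mul, ← Finset.sum_mul, Finset.sum_add_distrib, sum_kdeltaPref]
        rfl

/-- **(BoundXiIotaOne-1), summation half, `ι`-averaged, generic double-open family.**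
[cite: FitznerVanDerHofstad2017, Lemma 5.3 (BoundXiIotaOne-1) (arXiv:1506.07977v2 p. 50); §6.1 (6.x) (p. 59); §5.1 `(P⃗^ι)_b` (p. 49)] -/
theorem invTwoD_mul_sum_tsum_le_vecPiota_matAbar_vecPE (L : Letters d) {A : DirBlockFamily d}
    (hA : ∀ κ a b, IsTransInv (A κ a b)) (Ξι : Fin d × Bool → Site d → ℝ≥0∞)
    (hΞ : ∀ ι x, Ξι ι x ≤ ∑' u, ∑' w, ∑' t, ∑' z, ∑ κ : Fin d × Bool, ∑ a : Fin 3, ∑ b : Fin 3,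
      (kdeltaPref ι κ a u w + blockPiota L ι a u w) * A κ a b u w t z * blockPE L b (t - x) (z - x)) :
    invTwoD d * ∑ ι : Fin d × Bool, ∑' x, Ξι ι x ≤ vecPiota L ᵥ* matAbar A ⬝ᵥ vecPE L := by
  have h2 : ∑' x, ∑ ι : Fin d × Bool, Ξι ι x ≤ vecP (piotaFull L) ᵥ* matAbar A ⬝ᵥ vecPE L :=
    tsum_le_vecP_vecMul_matAbar_dotProduct_vecPE L hA (piotaFull L) (fun x => ∑ ι : Fin d × Bool, Ξι ι x)
      (sum_le_xSpaceBound_piotaFull_of L A Ξι hΞ)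
  rw [← tsum_finsetSum, ← invTwoD_mul_vecP_piotaFull_vecMul_dotProduct L (matAbar A) (vecPE L)]
  gcongr

/-- **(BoundXiIotaOne-1), summation half, fixed direction under symmetry, generic double-open family.**
[cite: FitznerVanDerHofstad2017, Lemma 5.3 (BoundXiIotaOne-1) (arXiv:1506.07977v2 p. 50); §6.1 (p. 59)] -/
theorem tsum_le_vecPiota_matAbar_vecPE_of_symm (L : Letters d) {A : DirBlockFamily d}
    (hA : ∀ κ a b, IsTransInv (A κ a b)) (Ξι : Fin d × Bool → Site d → ℝ≥0∞)
    (hΞ : ∀ ι x, Ξι ι x ≤ ∑' u, ∑' w, ∑' t, ∑' z, ∑ κ : Fin d × Bool, ∑ a : Fin 3, ∑ b : Fin 3,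
      (kdeltaPref ι κ a u w + blockPiota L ι a u w) * A κ a b u w t z * blockPE L b (t - x) (z - x))
    (ι₀ : Fin d × Bool) (hsym : ∀ ι, ∑' x, Ξι ι x = ∑' x, Ξι ι₀ x) :
    ∑' x, Ξι ι₀ x ≤ vecPiota L ᵥ* matAbar A ⬝ᵥ vecPE L := by
  have hd : d ≠ 0 := Nat.pos_iff_ne_zero.1 ι₀.1.pos
  have h := invTwoD_mul_sum_tsum_le_vecPiota_matAbar_vecPE L hA Ξι hΞ
  simp_rw [hsym, Finset.sum_const, Finset.card_univ, nsmul_eq_mul] at h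
  rwa [invTwoD_mul_card_mul hd] at h

/-- **(BoundXiIotaOne-1) for `Ξ^{(N),ι}_p`, summation half, generic double-open family.**
[cite: FitznerVanDerHofstad2017, Lemma 5.3 (BoundXiIotaOne-1) (arXiv:1506.07977v2 p. 50); §6.1 (6.x) (p. 59); §3.5 (p. 30)] -/
theorem tsum_ofReal_nobleXiIotaN_le_vecPiota_matAbar_vecPE (L : Letters d) {A : DirBlockFamily d}
    (hA : ∀ κ a b, IsTransInv (A κ a b)) (p : unitInterval) (N : ℕ)
    (hΞ : ∀ ι x, ENNReal.ofReal (nobleXiIotaN d p (𝐞 ι) N x)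
      ≤ ∑' u, ∑' w, ∑' t, ∑' z, ∑ κ : Fin d × Bool, ∑ a : Fin 3, ∑ b : Fin 3,
        (kdeltaPref ι κ a u w + blockPiota L ι a u w) * A κ a b u w t z * blockPE L b (t - x) (z - x))
    (ι₀ : Fin d × Bool) :
    ∑' x, ENNReal.ofReal (nobleXiIotaN d p (𝐞 ι₀) N x) ≤ vecPiota L ᵥ* matAbar A ⬝ᵥ vecPE L :=
  tsum_le_vecPiota_matAbar_vecPE_of_symm L hA (fun ι x => ENNReal.ofReal (nobleXiIotaN d p (𝐞 ι) N x)) hΞ ι₀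
    fun ι => tsum_ofReal_nobleXiIotaN_exch p N ι ι₀

/-! ## E. Instances on the primed element `(Ā^ι)' = matAbarIota' L` -/

/-- **(6.5) on the primed element**: `Σ_x Ξ(x) ≤ P⃗^S (Ā^ι)' P⃗^E` from the `x`-space bound (6.4) written with
`blockAbar'`. [cite: FitznerVanDerHofstad2017, Lemma 5.2 first display, §6.1 (6.4)–(6.5) (arXiv:1506.07977v2 pp. 50, 58)] -/
theorem tsum_le_vecPS_matAbarIota'_vecPE (L : Letters d) (Ξ : Site d → ℝ≥0∞)
    (hΞ : ∀ x, Ξ x ≤ ∑' u, ∑' w, ∑' t, ∑' z, ∑ ι : Fin d × Bool, ∑ a : Fin 3, ∑ b : Fin 3,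
      blockPS L a u w * blockAbar' L ι a b u w t z * blockPE L b (t - x) (z - x)) :
    ∑' x, Ξ x ≤ vecPS L ᵥ* matAbarIota' L ⬝ᵥ vecPE L :=
  tsum_le_vecP_vecMul_matAbar_dotProduct_vecPE L (isTransInv_blockAbar' L) (blockPS L) Ξ hΞ

/-- **Lemma 5.3 first display on the primed element, fixed direction, no trivial term**:
`Σ_x Ξ(x) ≤ vecP (P^{ι₀,·}) ᵛ* (Ā^ι)' ⬝ P⃗^E`. [cite: FitznerVanDerHofstad2017, Lemma 5.3 first display (arXiv:1506.07977v2 p. 50); §6.1 (p. 59)] -/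
theorem tsum_le_vecPiota_matAbarIota'_vecPE (L : Letters d) (ι₀ : Fin d × Bool) (Ξ : Site d → ℝ≥0∞)
    (hΞ : ∀ x, Ξ x ≤ ∑' u, ∑' w, ∑' t, ∑' z, ∑ ι : Fin d × Bool, ∑ a : Fin 3, ∑ b : Fin 3,
      blockPiota L ι₀ a u w * blockAbar' L ι a b u w t z * blockPE L b (t - x) (z - x)) :
    ∑' x, Ξ x ≤ vecP (blockPiota L ι₀) ᵥ* matAbarIota' L ⬝ᵥ vecPE L :=
  tsum_le_vecP_vecMul_matAbar_dotProduct_vecPE L (isTransInv_blockAbar' L) (blockPiota L ι₀) Ξ hΞ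

/-- **(BoundXiIotaOne-1) on the primed element, `ι`-averaged with the trivial term**:
`(1/2d) Σ_ι Σ_x Ξ^ι(x) ≤ P⃗^ι (Ā^ι)' P⃗^E`. [cite: FitznerVanDerHofstad2017, Lemma 5.3 (BoundXiIotaOne-1) (arXiv:1506.07977v2 p. 50); §6.1 (6.x) (p. 59)] -/
theorem invTwoD_mul_sum_tsum_le_vecPiota_matAbarIota'_vecPE (L : Letters d)
    (Ξι : Fin d × Bool → Site d → ℝ≥0∞)
    (hΞ : ∀ ι x, Ξι ι x ≤ ∑' u, ∑' w, ∑' t, ∑' z, ∑ κ : Fin d × Bool, ∑ a : Fin 3, ∑ b : Fin 3,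
      (kdeltaPref ι κ a u w + blockPiota L ι a u w) * blockAbar' L κ a b u w t z * blockPE L b (t - x) (z - x)) :
    invTwoD d * ∑ ι : Fin d × Bool, ∑' x, Ξι ι x ≤ vecPiota L ᵥ* matAbarIota' L ⬝ᵥ vecPE L :=
  invTwoD_mul_sum_tsum_le_vecPiota_matAbar_vecPE L (isTransInv_blockAbar' L) Ξι hΞ

/-- **(BoundXiIotaOne-1) for `Ξ^{(N),ι}_p` on the primed element**: if `Ξ^{(N),ι}_p` obeys (6.x) with `blockAbar'`
for every `ι`, then `Σ_x Ξ^{(N),ι₀}_p(x) ≤ P⃗^ι (Ā^ι)' P⃗^E` for every `ι₀`.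
[cite: FitznerVanDerHofstad2017, Lemma 5.3 (BoundXiIotaOne-1) (arXiv:1506.07977v2 p. 50); §6.1 (6.x) (p. 59); §3.5 (p. 30)] -/
theorem tsum_ofReal_nobleXiIotaN_le_vecPiota_matAbarIota'_vecPE (L : Letters d) (p : unitInterval) (N : ℕ)
    (hΞ : ∀ ι x, ENNReal.ofReal (nobleXiIotaN d p (𝐞 ι) N x)
      ≤ ∑' u, ∑' w, ∑' t, ∑' z, ∑ κ : Fin d × Bool, ∑ a : Fin 3, ∑ b : Fin 3,
        (kdeltaPref ι κ a u w + blockPiota L ι a u w) * blockAbar' L κ a b u w t z * blockPE L b (t - x) (z - x))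
    (ι₀ : Fin d × Bool) :
    ∑' x, ENNReal.ofReal (nobleXiIotaN d p (𝐞 ι₀) N x) ≤ vecPiota L ᵥ* matAbarIota' L ⬝ᵥ vecPE L :=
  tsum_ofReal_nobleXiIotaN_le_vecPiota_matAbar_vecPE L (isTransInv_blockAbar' L) p N hΞ ι₀

end Literature.Probability.FitznerVanDerHofstad2017.NobleBlocks

end
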